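import Mathlib.Probability.Kernel.Composition.IntegralCompProd
import Mathlib.Probability.Kernel.Composition.MeasureComp
import Mathlib.Probability.Kernel.MeasurableIntegral
import Literature.Barriers.CriticalPhenomena.PositionSpaceRGNonGibbsian
import Literature.Probability.LatticeModels.GibbsSpecificationProofs
import Literature.Probability.LatticeModels.PlusMinusStateGibbs
import HarnessLib

/-!
# Barrier `PositionSpaceRGNonGibbsian` (van Enter–Fernández–Sokal 1993, Theorem 4.2): the proof
# architecture — the Griffiths–Pearce–Israel estimate (4.32) as a named fact, and the proved
# reduction of Theorem 4.2 to it

Companion ("Proofs") file of `Literature/Barriers/CriticalPhenomena/PositionSpaceRGNonGibbsian.lean`,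
whose barrier statement `PositionSpaceRGNonGibbsian` is literally the named fact
`NonGibbs.VEFS1993_thm42` (van Enter–Fernández–Sokal 1993, Theorem 4.2, transcribed for `d ≥ 3`).
The printed proof (§4.1.2 Steps 0–3, §4.2, §4.3.1 Steps 1, 2.1–2.4, 3; arXiv:hep-lat/9210032
pp. 92–112) is a theory of its own (conditioning on infinite spin sets, Prop. 2.25; GKS, FKG and
Lebowitz inequalities; Lee–Yang and Lebowitz–Penrose analyticity; Griffiths' comparison of the
diluted `d`-dimensional internal-spin system with the `(d-1)`-dimensional Ising model), so the
theorem is decomposed here (D-0014: Literature is sorry-free; nothing below is asserted without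
proof except the named fact `VEFS1993_eq432 : Prop`).

## What the source prints (section/equation numbers of the paper, pages of the arXiv preprint)

* §4.3.1, "Conclusion of the argument" (p. 112): "We conclude that in every neighborhood of
  `ω'_alt` there are open sets `𝒩₊`, `𝒩₋` such that
  `E_{μT}(σ'_0 | {σ'_i}_{i≠0})(ω₁) - E_{μT}(σ'_0 | {σ'_i}_{i≠0})(ω₂) ≥ δ > 0` (4.32) for
  `ω₁ ∈ 𝒩₊` and `ω₂ ∈ 𝒩₋`. As in the 2-dimensional case, this implies the non-quasilocality of
  the renormalized measure `μT`, for any original Gibbs measure `μ`. This works for any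
  temperature below the critical temperature of the undiluted `(d-1)`-dimensional Ising model. We
  have therefore proven: **Theorem 4.2** …".
* §4.3.1 Step 1 (p. 107): "`ω'_special` [is] the fully alternating configuration `ω'_alt`"
  (eq. (4.2): `σ'_{i₁,i₂} = (-1)^{i₁+i₂}`); Step 2 (p. 107): "we take `ω'₊` (resp. `ω'₋`) to be
  the configuration with all spins `+` (resp. all spins `-`)"; §4.2 Step 2, eqs. (4.24)–(4.25)
  (p. 105): "a basis for the neighborhoods `𝒩 ∋ ω'_alt` is given by sets of the form
  `𝒩_R = {ω' : ω' = ω'_alt on Λ_R, ω' arbitrary outside Λ_R}`", "`𝒩_{R,R',+} = {ω' : ω' = ω'_alt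
  on Λ_R, ω' = ω'₊ on Λ_{R'} ∖ Λ_R, ω' arbitrary outside Λ_{R'}}`" and `𝒩_{R,R',-}` likewise,
  "We then have to prove that `R'` can be chosen as a function of `R` (`R < R' < ∞`) so that
  `μ(f)` satisfies the claimed bounds", namely (p. 105) "numbers `c₊`, `c₋` with `c₊ - c₋ ≥ δ`
  such that for every `ω' ∈ 𝒩₊` [resp. `ω' ∈ 𝒩₋`] … `μ(f) ≥ c₊` [resp. `μ(f) ≤ c₋`]"; `Λ_R` is
  "a square of side `2R + 1` centered at the origin" (p. 96), i.e. the tree's `box d R`.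
* Why open sets and a.e. bounds (§4.1.2 Step 0, p. 94, and §4.2, p. 105): "this computation of
  the conditional probabilities is asserted to be valid only for `μ`-almost-every [image
  configuration]; indeed, conditional probabilities are only defined up to modifications on a set
  of measure zero. Therefore, in order to prove non-quasilocality we must prove not only that this
  particular version of the conditional probabilities is a discontinuous function, but that no
  function obtained from this one by modification on a set of `μ`-measure zero can be
  continuous"; "we must prove our bounds for a nonempty open set of configurations `ω'`".
* The conclusion mechanism (§4.1.2, p. 101): "In the product topology `A_{R,+}` and `A_{R,-}` are
  open sets — in particular, they have strictly positive `(μT)`-measure … the conditional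
  expectations of `σ'_{0,0}` are … essentially discontinuous: no modification on a set of
  `(μT)`-measure zero can make them continuous at `ω'_alt`. Now, for systems with a finite
  single-spin space (such as the Ising model), continuity is equivalent to quasilocality.
  Therefore, what we have really proven is that the renormalized measure `μT` is not consistent
  with any quasilocal specification." Consistency (Definition 2.6, eq. (2.18), p. 28): "for each
  `Λ ∈ 𝒮` and `A ∈ 𝓕`, `E_μ(χ_A | 𝓕_{Λᶜ}) = π_Λ(·, A)` `μ`-a.e."; Proposition 2.7 (p. 28): this
  is equivalent to "`μ = μπ_Λ`" (the tree's DLR form `IsGibbsMeasure`); Definition 2.14 /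
  §2.3.4 (p. 33): Feller = "`f ∈ C(Ω)` implies `π_Λ f ∈ C(Ω)`", equal to quasilocality for a
  finite single-spin space.

## What is formalised (namespace `Literature.Barriers.CriticalPhenomena.NonGibbs`)

* Definitions: `altConfig d` (`ω'_alt`, eq. (4.2) in `d` dimensions), `plusSelected d R R'` /
  `minusSelected d R R'` (`𝒩_{R,R',±}`, eq. (4.25) with `ω'_± = ±1`), `condExpSpinAtOrigin d ν`
  (`E_ν(σ'_0 | {σ'_x}_{x ≠ 0})`, Mathlib `condExp` for the cylinder σ-algebra of `{0}ᶜ`),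
  `IsSpecification.piKernel` (a specification kernel as a Mathlib kernel on the full product
  σ-algebra), `isingCylinderLB` (an explicit finite-energy constant).
* Named fact (not proved): `VEFS1993_eq432` — the estimate (4.32) with (4.25)–(4.27), i.e. the
  outcome of Steps 0–3 of §4.3.1 for `d ≥ 3`, `b = 2`, `β > β_c(d-1)`, zero field.
* Proved: `mem_iff_mem_of_measurableSet_cylinderEvents` (events in `𝓕_P` depend only on the spins
  in `P`); `IsGibbsMeasure.comp_piKernel` (DLR in Mathlib's `κ ∘ₘ ν = ν` form) and
  `IsGibbsMeasure.integral_ae_eq_condExp` (Proposition 2.7 (c) ⇒ (a) / Georgii Remark 1.24: for a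
  measure consistent with a specification, `π_Λ f` is a version of `E(f | 𝓕_{Λᶜ})`);
  `isingMeasure_fixed_cylinder_ge` and `measure_cylinder_pos_of_mem_isingGibbsMeasures` (finite
  energy: infinite-volume Ising Gibbs measures charge every cylinder) with
  `map_decimate_plusSelected_pos` / `map_decimate_minusSelected_pos` ("open sets … have strictly
  positive `(μT)`-measure" for the sets `𝒩_{R,R',±}`); and the assembly
  `VEFS1993_thm42_of_eq432 : VEFS1993_eq432 → VEFS1993_thm42`,
  `positionSpaceRGNonGibbsian_of_eq432 : VEFS1993_eq432 → PositionSpaceRGNonGibbsian` — the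
  "Conclusion of the argument" of §4.1.2/§4.3.1 made rigorous: a Feller specification consistent
  with `μT` would provide a continuous version of `E_{μT}(σ'_0 | {σ'_x}_{x≠0})`, contradicting
  (4.32) at `ω'_alt` because the sets `𝒩_{R,R',±}` shrink to `ω'_alt` and have positive measure.

* Proved (barrier audit, non-vacuity): `isFeller_isingSpecification` — the Ising specification of
  any countable locally finite graph is Feller (quasilocal): `η ↦ γ_Λ(f | η)` is a finite
  Boltzmann-weighted sum of continuous functions of `η`; hence
  `isQuasilocalMeasure_of_mem_isingGibbsMeasures` (every infinite-volume Ising Gibbs measure is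
  quasilocal, §2.3.3), `exists_isQuasilocalMeasure` (the conclusion `¬ IsQuasilocalMeasure (μT₂)` of
  Theorem 4.2 is not true for lack of quasilocal measures),
  `renormalizedHamiltonianExists_decimate_one_of_nonneg` (the technique class
  `RenormalizedHamiltonianExists d (decimate d 1) β h` IS inhabited for `β ≥ 0`: the identity step acts
  on Hamiltonians) and `renormalizedHamiltonianExists_one_not_two` (under Theorem 4.2 the spacing-2
  step does not, at the same `(β, 0)`, `β > β_c(d-1)`, `d ≥ 3`): the obstruction is a genuine effect of
  the coarse-graining, not an artefact of an uninhabitable predicate.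

What remains for `PositionSpaceRGNonGibbsian_holds` is exactly `VEFS1993_eq432` (Steps 0–3; discharged
downstream in `…Holds.lean`).
-/

noncomputable section

namespace Literature.Barriers.CriticalPhenomena.NonGibbs

open MeasureTheory ProbabilityTheory Filter Topology Literature.Probability.LatticeModels
open scoped ENNReal ProbabilityTheory BoundedContinuousFunction

/-! ### Events in `𝓕_P` depend only on the spins in `P` -/

section Cylinder

variable {V S : Type*} [MeasurableSpace S]

/-- An event measurable for the cylinder σ-algebra `𝓕_P` (Mathlib `cylinderEvents P`) is
determined by the spins in `P`: configurations agreeing on `P` are both in or both out. (Used for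
properness, van Enter–Fernández–Sokal Definition 2.5 (b): "`π_Λ` is `𝓕_{Λᶜ}`-proper".)
[cite: VanenterFernandezSokal1993, Definition 2.5] -/
theorem mem_iff_mem_of_measurableSet_cylinderEvents {P : Set V} {B : Set (V → S)}
    (hB : MeasurableSet[cylinderEvents (X := fun _ : V => S) P] B) {σ τ : V → S}
    (h : ∀ x ∈ P, σ x = τ x) : σ ∈ B ↔ τ ∈ B := by
  have hle : cylinderEvents (X := fun _ : V => S) P ≤
      MeasurableSpace.comap (fun σ : V → S => P.restrict σ) ⊤ := by
    refine iSup₂_le fun x hx => ?_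
    have hcomp : (fun σ : V → S => σ x) =
        (fun g : P → S => g ⟨x, hx⟩) ∘ fun σ : V → S => P.restrict σ := rfl
    rw [hcomp, ← MeasurableSpace.comap_comp]
    exact MeasurableSpace.comap_mono le_top
  rcases hle _ hB with ⟨t, -, ht⟩
  have hr : P.restrict σ = P.restrict τ := funext fun x => h x x.2
  rw [← ht]
  simp only [Set.mem_preimage, hr]

end Cylinder

/-! ### Consistency with a specification gives versions of the conditional expectations
(van Enter–Fernández–Sokal Definition 2.6 / Proposition 2.7) -/

section Specification

variable {V S : Type*} [MeasurableSpace S] {γ : Specification V S}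

/-- The `Λ`-kernel of a specification as a Mathlib kernel whose source carries the full product
σ-algebra (weakening the `𝓕_{Λᶜ}`-measurability of `IsSpecification.toKernel`), so that Mathlib's
composition `κ ∘ₘ ν` and `Kernel.integral_comp` apply.
[cite: VanenterFernandezSokal1993, Definition 2.5 (a)] -/
def _root_.Literature.Probability.LatticeModels.IsSpecification.piKernel (hγ : IsSpecification γ) (Λ : Finset V) :
    Kernel (V → S) (V → S) :=
  (hγ.toKernel Λ).comap id (measurable_id'' cylinderEvents_le_pi)

/-- `hγ.piKernel Λ η = γ Λ η`. [cite: VanenterFernandezSokal1993, Definition 2.5] -/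
@[simp] theorem _root_.Literature.Probability.LatticeModels.IsSpecification.piKernel_apply (hγ : IsSpecification γ)
    (Λ : Finset V) (η : V → S) : hγ.piKernel Λ η = γ Λ η := rfl

/-- The kernels of a specification are Markov (probability) kernels.
[cite: VanenterFernandezSokal1993, Definition 2.5] -/
theorem _root_.Literature.Probability.LatticeModels.IsSpecification.isMarkovKernel_piKernel (hγ : IsSpecification γ)
    (Λ : Finset V) : IsMarkovKernel (hγ.piKernel Λ) :=
  ⟨fun η => hγ.isProbability Λ η⟩

/-- **DLR equations in Mathlib's composition form**: a measure consistent with the specification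
`γ` satisfies `γ_Λ ∘ₘ ν = ν` ("`μ = μπ_Λ`", van Enter–Fernández–Sokal Proposition 2.7 (c); the
tree's `IsGibbsMeasure` is the junk-free set-wise form of this identity).
[cite: VanenterFernandezSokal1993, Proposition 2.7 (c)] -/
theorem _root_.Literature.Probability.LatticeModels.IsGibbsMeasure.comp_piKernel (hγ : IsSpecification γ)
    {ν : Measure (V → S)} (hν : IsGibbsMeasure γ ν) (Λ : Finset V) :
    hγ.piKernel Λ ∘ₘ ν = ν := by
  ext A hA
  rw [Measure.bind_apply hA (Kernel.aemeasurable _)]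
  exact hν.2 Λ A hA

/-- Properness in integrated form: for `s ∈ 𝓕_{Λᶜ}`,
`∫ 1_s f dγ_Λ(·|η) = 1_s(η) ∫ f dγ_Λ(·|η)` (van Enter–Fernández–Sokal Definition 2.5 (b)).
[cite: VanenterFernandezSokal1993, Definition 2.5 (b)] -/
theorem _root_.Literature.Probability.LatticeModels.IsSpecification.integral_indicator_eq (hγ : IsSpecification γ)
    (Λ : Finset V) {s : Set (V → S)}
    (hs : MeasurableSet[cylinderEvents (X := fun _ : V => S) ((↑Λ : Set V)ᶜ)] s)
    (f : (V → S) → ℝ) (η : V → S) :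
    ∫ σ, s.indicator f σ ∂(γ Λ η) = s.indicator (fun η => ∫ σ, f σ ∂(γ Λ η)) η := by
  have hae : ∀ᵐ σ ∂(γ Λ η), (σ ∈ s ↔ η ∈ s) := by
    filter_upwards [hγ.proper Λ η] with σ hσ
    exact mem_iff_mem_of_measurableSet_cylinderEvents hs fun x hx =>
      hσ x (by simpa using hx)
  by_cases hη : η ∈ s
  · rw [Set.indicator_of_mem hη]
    refine integral_congr_ae ?_
    filter_upwards [hae] with σ hσ
    rw [Set.indicator_of_mem (hσ.2 hη)]
  · rw [Set.indicator_of_notMem hη]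
    rw [← integral_zero (V → S) ℝ]
    refine integral_congr_ae ?_
    filter_upwards [hae] with σ hσ
    rw [Set.indicator_of_notMem (fun h => hη (hσ.1 h))]

/-- **Consistency gives versions of the conditional expectations** (van Enter–Fernández–Sokal
Definition 2.6, eq. (2.18), with Proposition 2.7 (c) ⇒ (a); Georgii 2011, Remark 1.24): if `ν`
is consistent with the specification `γ` (DLR equations, the tree's `IsGibbsMeasure γ ν`), then
for every finite `Λ` and every bounded measurable observable `f`, the function
`η ↦ (π_Λ f)(η) = ∫ f dγ_Λ(·|η)` is a version of the conditional expectation `E_ν(f | 𝓕_{Λᶜ})`.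
(This is the `→` half of the tree's named fact `Literature.Probability.LatticeModels.isGibbsMeasure_iff_condExp`, for
bounded measurable `f`.) [cite: VanenterFernandezSokal1993, Definition 2.6 and Proposition 2.7] -/
theorem _root_.Literature.Probability.LatticeModels.IsGibbsMeasure.integral_ae_eq_condExp (hγ : IsSpecification γ)
    {ν : Measure (V → S)} (hν : IsGibbsMeasure γ ν) (Λ : Finset V) {f : (V → S) → ℝ}
    (hf : Measurable f) {C : ℝ} (hC : ∀ σ, ‖f σ‖ ≤ C) :
    (fun η => ∫ σ, f σ ∂(γ Λ η)) =ᵐ[ν] ν[f | cylinderEvents (X := fun _ : V => S) ((↑Λ : Set V)ᶜ)] := by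
  haveI := hν.isProbabilityMeasure
  haveI := hγ.isMarkovKernel_piKernel Λ
  have hm : cylinderEvents (X := fun _ : V => S) ((↑Λ : Set V)ᶜ) ≤ MeasurableSpace.pi :=
    cylinderEvents_le_pi
  -- `π_Λ f` is `𝓕_{Λᶜ}`-measurable and bounded by `C`
  have hgm : StronglyMeasurable[cylinderEvents (X := fun _ : V => S) ((↑Λ : Set V)ᶜ)]
      (fun η => ∫ σ, f σ ∂(γ Λ η)) :=
    hf.stronglyMeasurable.integral_kernel (κ := hγ.toKernel Λ)
  have hgb : ∀ η, ‖∫ σ, f σ ∂(γ Λ η)‖ ≤ C := fun η => by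
    haveI := hγ.isProbability Λ η
    simpa using norm_integral_le_of_norm_le_const (μ := γ Λ η) (ae_of_all _ hC)
  have hg_int : Integrable (fun η => ∫ σ, f σ ∂(γ Λ η)) ν :=
    (integrable_const C).mono' (hgm.mono hm).aestronglyMeasurable (ae_of_all _ hgb)
  have hf_int : Integrable f ν :=
    (integrable_const C).mono' hf.aestronglyMeasurable (ae_of_all _ hC)
  refine ae_eq_condExp_of_forall_setIntegral_eq hm hf_int (fun s _ _ => hg_int.integrableOn)
    (fun s hs _ => ?_) hgm.aestronglyMeasurable
  have hs' : MeasurableSet s := hm s hs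
  -- the DLR equation for the bounded observable `1_s f`, via `γ_Λ ∘ₘ ν = ν`
  have hfi_bound : ∀ σ, ‖s.indicator f σ‖ ≤ C := fun σ =>
    (norm_indicator_le_norm_self f σ).trans (hC σ)
  have hcomp : (hγ.piKernel Λ ∘ₖ Kernel.const Unit ν) () = ν := by
    rw [Kernel.comp_apply, Kernel.const_apply]
    exact hν.comp_piKernel hγ Λ
  have hfi : Integrable (s.indicator f) ((hγ.piKernel Λ ∘ₖ Kernel.const Unit ν) ()) := by
    rw [hcomp]
    exact (integrable_const C).mono' (hf.indicator hs').aestronglyMeasurable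
      (ae_of_all _ hfi_bound)
  have key : ∫ σ, s.indicator f σ ∂ν = ∫ η, ∫ σ, s.indicator f σ ∂(γ Λ η) ∂ν := by
    have := Kernel.integral_comp hfi
    rwa [hcomp, Kernel.const_apply] at this
  calc ∫ η in s, (∫ σ, f σ ∂(γ Λ η)) ∂ν
      = ∫ η, s.indicator (fun η => ∫ σ, f σ ∂(γ Λ η)) η ∂ν := (integral_indicator hs').symm
    _ = ∫ η, ∫ σ, s.indicator f σ ∂(γ Λ η) ∂ν := by
        refine integral_congr_ae (ae_of_all _ fun η => ?_)
        exact (hγ.integral_indicator_eq Λ hs f η).symm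
    _ = ∫ σ, s.indicator f σ ∂ν := key.symm
    _ = ∫ σ in s, f σ ∂ν := integral_indicator hs'

end Specification

/-! ### Finite energy: Ising Gibbs measures charge every cylinder -/

section FiniteEnergy

variable {W : Type*} (G : SimpleGraph W) [DecidableEq W] [G.LocallyFinite]

omit [DecidableEq W] [G.LocallyFinite] in
/-- `|σ_x σ_y| ≤ 1` for the bond observable. [cite: FriedliVelenik2017, §3.1] -/
theorem abs_bondSpin_le_one (σ : SpinConfig W) (e : Sym2 W) : |bondSpin σ e| ≤ 1 := by
  induction e using Sym2.ind with
  | _ x y =>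
    rw [bondSpin_mk, abs_mul]
    rcases spinAt_eq_one_or_eq_neg_one x σ with hx | hx <;>
      rcases spinAt_eq_one_or_eq_neg_one y σ with hy | hy <;> simp [hx, hy]

/-- A uniform bound on the fixed-boundary-condition Hamiltonian:
`|H_{Λ;h}^η(σ)| ≤ |ℰ_Λ^b| + |h| |Λ|`, for every `η` and `σ`. [cite: FriedliVelenik2017, §3.1 eq. (3.6)] -/
theorem abs_isingHamiltonian_fixed_le (Λ : Finset W) (h : ℝ) (η σ : SpinConfig W) :
    |isingHamiltonian G Λ h (.fixed η) σ| ≤ (edgesTouching G Λ).card + |h| * Λ.card := by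
  unfold isingHamiltonian
  simp only [interactionEdges_fixed]
  have h1 : |∑ e ∈ edgesTouching G Λ, bondSpin σ e| ≤ (edgesTouching G Λ).card := by
    calc |∑ e ∈ edgesTouching G Λ, bondSpin σ e|
        ≤ ∑ e ∈ edgesTouching G Λ, |bondSpin σ e| := Finset.abs_sum_le_sum_abs _ _
      _ ≤ ∑ e ∈ edgesTouching G Λ, (1 : ℝ) :=
          Finset.sum_le_sum fun e _ => abs_bondSpin_le_one σ e
      _ = (edgesTouching G Λ).card := by simp
  have h2 : |∑ x ∈ Λ, spinAt x σ| ≤ Λ.card := by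
    calc |∑ x ∈ Λ, spinAt x σ| ≤ ∑ x ∈ Λ, |spinAt x σ| := Finset.abs_sum_le_sum_abs _ _
      _ ≤ ∑ x ∈ Λ, (1 : ℝ) := Finset.sum_le_sum fun x _ => by
          rcases spinAt_eq_one_or_eq_neg_one x σ with hx | hx <;> simp [hx]
      _ = Λ.card := by simp
  calc |-(∑ e ∈ edgesTouching G Λ, bondSpin σ e) - h * ∑ x ∈ Λ, spinAt x σ|
      ≤ |-(∑ e ∈ edgesTouching G Λ, bondSpin σ e)| + |h * ∑ x ∈ Λ, spinAt x σ| := abs_sub _ _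
    _ = |∑ e ∈ edgesTouching G Λ, bondSpin σ e| + |h| * |∑ x ∈ Λ, spinAt x σ| := by
        rw [abs_neg, abs_mul]
    _ ≤ (edgesTouching G Λ).card + |h| * Λ.card := by gcongr

/-- An explicit finite-energy constant: `ε = e^{-|β| M} / (2^{|Λ|} e^{|β| M})` with
`M = |ℰ_Λ^b| + |h| |Λ|` the uniform bound on the Hamiltonian. [cite: FriedliVelenik2017, §3.1] -/
def isingCylinderLB (Λ : Finset W) (β h : ℝ) : ℝ :=
  Real.exp (-(|β| * ((edgesTouching G Λ).card + |h| * Λ.card))) /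
    (Fintype.card (Λ → ℤˣ) * Real.exp (|β| * ((edgesTouching G Λ).card + |h| * Λ.card)))

/-- The finite-energy constant is positive. [cite: FriedliVelenik2017, §3.1] -/
theorem isingCylinderLB_pos (Λ : Finset W) (β h : ℝ) : 0 < isingCylinderLB G Λ β h := by
  unfold isingCylinderLB
  have : (0 : ℝ) < Fintype.card (Λ → ℤˣ) := by exact_mod_cast Fintype.card_pos
  positivity

/-- **Finite energy for the finite-volume Ising measure**: with any fixed boundary condition `η`,
the Gibbs probability that the spins in `Λ` take prescribed values is at least
`isingCylinderLB G Λ β h > 0`, uniformly in `η` (the Boltzmann weights are bounded above and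
below by `e^{±|β| M}`). [cite: FriedliVelenik2017, §3.1 Def. 3.1 and eq. (3.7)] -/
theorem isingMeasure_fixed_cylinder_ge (Λ : Finset W) (β h : ℝ) (η τ : SpinConfig W) :
    ENNReal.ofReal (isingCylinderLB G Λ β h) ≤
      isingMeasure G Λ β h (.fixed η) {σ | ∀ x ∈ Λ, σ x = τ x} := by
  classical
  set C : Set (SpinConfig W) := {σ | ∀ x ∈ Λ, σ x = τ x} with hCdef
  have hC : MeasurableSet C := by
    have : C = ⋂ x ∈ Λ, (fun σ : SpinConfig W => σ x) ⁻¹' {τ x} := by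
      ext σ; simp [hCdef]
    rw [this]
    exact Finset.measurableSet_biInter Λ fun x _ =>
      measurable_pi_apply x (measurableSet_singleton _)
  rw [isingMeasure_apply_of_measurableSet G Λ β h (.fixed η) hC]
  refine ENNReal.ofReal_le_ofReal ?_
  set M : ℝ := (edgesTouching G Λ).card + |h| * Λ.card with hM
  -- weights are between `e^{-|β| M}` and `e^{|β| M}`
  have hw_lower : ∀ τ' : Λ → ℤˣ, Real.exp (-(|β| * M)) ≤ isingWeight G Λ β h (.fixed η) τ' := by
    intro τ'
    unfold isingWeight
    refine Real.exp_le_exp.2 ?_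
    have hb := abs_isingHamiltonian_fixed_le G Λ h η (glue Λ τ' (.fixed η))
    have : |β * isingHamiltonian G Λ h (.fixed η) (glue Λ τ' (.fixed η))| ≤ |β| * M := by
      rw [abs_mul]; exact mul_le_mul_of_nonneg_left hb (abs_nonneg β)
    rw [neg_mul]
    linarith [le_abs_self (β * isingHamiltonian G Λ h (.fixed η) (glue Λ τ' (.fixed η)))]
  have hw_upper : ∀ τ' : Λ → ℤˣ, isingWeight G Λ β h (.fixed η) τ' ≤ Real.exp (|β| * M) := by
    intro τ'
    unfold isingWeight
    refine Real.exp_le_exp.2 ?_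
    have hb := abs_isingHamiltonian_fixed_le G Λ h η (glue Λ τ' (.fixed η))
    have : |β * isingHamiltonian G Λ h (.fixed η) (glue Λ τ' (.fixed η))| ≤ |β| * M := by
      rw [abs_mul]; exact mul_le_mul_of_nonneg_left hb (abs_nonneg β)
    rw [neg_mul]
    linarith [neg_le_abs (β * isingHamiltonian G Λ h (.fixed η) (glue Λ τ' (.fixed η)))]
  -- the prescribed configuration contributes to the numerator
  set τ₀ : Λ → ℤˣ := fun x => τ x with hτ₀
  have hτ₀C : glue Λ τ₀ (.fixed η) ∈ C := fun x hx => by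
    rw [glue_apply_of_mem Λ τ₀ _ hx]
  have hnum : Real.exp (-(|β| * M)) ≤
      ∑ τ' : Λ → ℤˣ with glue Λ τ' (.fixed η) ∈ C, isingWeight G Λ β h (.fixed η) τ' :=
    (hw_lower τ₀).trans
      (Finset.single_le_sum (f := fun τ' => isingWeight G Λ β h (.fixed η) τ')
        (fun τ' _ => (isingWeight_pos G Λ β h _ τ').le)
        (Finset.mem_filter.2 ⟨Finset.mem_univ _, hτ₀C⟩))
  have hden : isingPartitionFunction G Λ β h (.fixed η) ≤
      Fintype.card (Λ → ℤˣ) * Real.exp (|β| * M) := by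
    unfold isingPartitionFunction
    calc ∑ τ' : Λ → ℤˣ, isingWeight G Λ β h (.fixed η) τ'
        ≤ ∑ _τ' : Λ → ℤˣ, Real.exp (|β| * M) := Finset.sum_le_sum fun τ' _ => hw_upper τ'
      _ = Fintype.card (Λ → ℤˣ) * Real.exp (|β| * M) := by
          rw [Finset.sum_const, nsmul_eq_mul, Finset.card_univ]
  unfold isingCylinderLB
  exact div_le_div₀ (Finset.sum_nonneg fun τ' _ => (isingWeight_pos G Λ β h _ τ').le) hnum
    (isingPartitionFunction_pos G Λ β h _) hden

variable {G}

/-- **Finite energy for infinite-volume Ising Gibbs measures**: a DLR Gibbs measure of the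
nearest-neighbour Ising model on `ℤ^d` gives positive probability to every cylinder
`{σ | σ = τ on Λ}` (DLR equation in `Λ` and the uniform bound
`isingMeasure_fixed_cylinder_ge`). This is the fact behind "open sets … have strictly positive
`(μT)`-measure" in van Enter–Fernández–Sokal's conclusion of the argument (§4.1.2, p. 101).
[cite: VanenterFernandezSokal1993, §4.1.2 Conclusion of the argument]
[cite: FriedliVelenik2017, Def. 6.13] -/
theorem measure_cylinder_pos_of_mem_isingGibbsMeasures {d : ℕ} {β h : ℝ}
    {μ : Measure (SpinConfig (Site d))} (hμ : μ ∈ isingGibbsMeasures d β h)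
    (Λ : Finset (Site d)) (τ : SpinConfig (Site d)) :
    0 < μ {σ | ∀ x ∈ Λ, σ x = τ x} := by
  rw [mem_isingGibbsMeasures_iff] at hμ
  haveI := hμ.isProbabilityMeasure
  have hC : MeasurableSet {σ : SpinConfig (Site d) | ∀ x ∈ Λ, σ x = τ x} := by
    have : {σ : SpinConfig (Site d) | ∀ x ∈ Λ, σ x = τ x} =
        ⋂ x ∈ Λ, (fun σ : SpinConfig (Site d) => σ x) ⁻¹' {τ x} := by
      ext σ; simp
    rw [this]
    exact Finset.measurableSet_biInter Λ fun x _ =>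
      measurable_pi_apply x (measurableSet_singleton _)
  rw [← hμ.2 Λ _ hC]
  have hpos : (0 : ℝ≥0∞) < ENNReal.ofReal (isingCylinderLB (zdGraph d) Λ β h) :=
    ENNReal.ofReal_pos.2 (isingCylinderLB_pos (zdGraph d) Λ β h)
  refine hpos.trans_le ?_
  calc ENNReal.ofReal (isingCylinderLB (zdGraph d) Λ β h)
      = ∫⁻ _η, ENNReal.ofReal (isingCylinderLB (zdGraph d) Λ β h) ∂μ := by
        rw [lintegral_const, measure_univ, mul_one]
    _ ≤ ∫⁻ η, isingSpecification (zdGraph d) β h Λ η {σ | ∀ x ∈ Λ, σ x = τ x} ∂μ :=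
        lintegral_mono fun η => isingMeasure_fixed_cylinder_ge (zdGraph d) Λ β h η τ

end FiniteEnergy

/-! ### The objects of the Griffiths–Pearce–Israel argument (§4.1.2, §4.2, §4.3.1) -/

section GPI

variable (d : ℕ)

/-- **The fully alternating image configuration** `ω'_alt`: `σ'_x = (-1)^{x₁ + ⋯ + x_d}`
(van Enter–Fernández–Sokal eq. (4.2) for `d = 2`; §4.3.1 Step 1: "As in the two-dimensional
case, we choose `ω'_special` to be the fully alternating configuration `ω'_alt`").
[cite: VanenterFernandezSokal1993, eq. (4.2) and §4.3.1 Step 1] -/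
def altConfig : SpinConfig (Site d) :=
  fun x => (-1) ^ (∑ i, x i)

/-- Unfolding `altConfig`. [cite: VanenterFernandezSokal1993, eq. (4.2)] -/
theorem altConfig_apply (x : Site d) : altConfig d x = (-1) ^ (∑ i, x i) := rfl

/-- The origin carries the image spin `+1` in `ω'_alt`. [cite: VanenterFernandezSokal1993, eq. (4.2)] -/
@[simp] theorem altConfig_zero : altConfig d 0 = 1 := by
  simp [altConfig]

/-- **The phase-selecting neighbourhoods `𝒩_{R,R',+}`** of `ω'_alt` (van Enter–Fernández–Sokal
eq. (4.25a) with `ω'₊ ≡ +1`, §4.3.1 Step 2): image configurations equal to `ω'_alt` on the cube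
`Λ_R = box d R` (side `2R+1`, centred at the origin), equal to `+1` on the annulus
`Λ_{R'} ∖ Λ_R`, and arbitrary outside `Λ_{R'}`.
[cite: VanenterFernandezSokal1993, eq. (4.25a) and §4.3.1 Step 2] -/
def plusSelected (R R' : ℕ) : Set (SpinConfig (Site d)) :=
  {ω | (∀ x ∈ box d R, ω x = altConfig d x) ∧ ∀ x ∈ box d R', x ∉ box d R → ω x = 1}

/-- **The phase-selecting neighbourhoods `𝒩_{R,R',-}`** (eq. (4.25b) with `ω'₋ ≡ -1`): `ω'_alt`
on `Λ_R`, `-1` on `Λ_{R'} ∖ Λ_R`, arbitrary outside `Λ_{R'}`.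
[cite: VanenterFernandezSokal1993, eq. (4.25b) and §4.3.1 Step 2] -/
def minusSelected (R R' : ℕ) : Set (SpinConfig (Site d)) :=
  {ω | (∀ x ∈ box d R, ω x = altConfig d x) ∧ ∀ x ∈ box d R', x ∉ box d R → ω x = -1}

variable {d}

/-- Membership in `𝒩_{R,R',+}`. [cite: VanenterFernandezSokal1993, eq. (4.25a)] -/
theorem mem_plusSelected_iff {R R' : ℕ} {ω : SpinConfig (Site d)} :
    ω ∈ plusSelected d R R' ↔
      (∀ x ∈ box d R, ω x = altConfig d x) ∧ ∀ x ∈ box d R', x ∉ box d R → ω x = 1 :=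
  Iff.rfl

/-- Membership in `𝒩_{R,R',-}`. [cite: VanenterFernandezSokal1993, eq. (4.25b)] -/
theorem mem_minusSelected_iff {R R' : ℕ} {ω : SpinConfig (Site d)} :
    ω ∈ minusSelected d R R' ↔
      (∀ x ∈ box d R, ω x = altConfig d x) ∧ ∀ x ∈ box d R', x ∉ box d R → ω x = -1 :=
  Iff.rfl

/-- `ω'_alt` patched to `+1` off `Λ_R` lies in `𝒩_{R,R',+}` (the sets (4.25) are nonempty).
[cite: VanenterFernandezSokal1993, eq. (4.25a)] -/
theorem plusSelected_nonempty (R R' : ℕ) : (plusSelected d R R').Nonempty := by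
  classical
  refine ⟨fun x => if x ∈ box d R then altConfig d x else 1, ?_, ?_⟩
  · intro x hx; simp [hx]
  · intro x _ hx; simp [hx]

/-- `𝒩_{R,R',±} ⊆ 𝒩_R = {ω' = ω'_alt on Λ_R}`, the basic neighbourhoods (4.24) of `ω'_alt`.
[cite: VanenterFernandezSokal1993, eqs. (4.24)–(4.25)] -/
theorem eqOn_box_of_mem_plusSelected {R R' : ℕ} {ω : SpinConfig (Site d)}
    (hω : ω ∈ plusSelected d R R') : ∀ x ∈ box d R, ω x = altConfig d x :=
  hω.1

/-- `𝒩_{R,R',-} ⊆ 𝒩_R`. [cite: VanenterFernandezSokal1993, eqs. (4.24)–(4.25)] -/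
theorem eqOn_box_of_mem_minusSelected {R R' : ℕ} {ω : SpinConfig (Site d)}
    (hω : ω ∈ minusSelected d R R') : ∀ x ∈ box d R, ω x = altConfig d x :=
  hω.1

variable (d)

/-- **The conditional expectation of the image spin at the origin given all other image spins**,
`E_ν(σ'_0 | {σ'_x}_{x ≠ 0})` (van Enter–Fernández–Sokal eqs. (4.14), (4.32)): Mathlib's
conditional expectation `ν[σ_0 | 𝓕_{{0}ᶜ}]` of the observable `spinAt 0` with respect to the
cylinder σ-algebra of the sites `≠ 0` — an a.e.-defined object, of which any specification
consistent with `ν` provides a version (`IsGibbsMeasure.integral_ae_eq_condExp`).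
[cite: VanenterFernandezSokal1993, eqs. (4.14) and (4.32)] -/
def condExpSpinAtOrigin (ν : Measure (SpinConfig (Site d))) : SpinConfig (Site d) → ℝ :=
  ν[spinAt 0 | cylinderEvents (X := fun _ : Site d => ℤˣ) ((↑({0} : Finset (Site d)) : Set (Site d))ᶜ)]

/-! ### The named fact: the estimate (4.32) (Steps 0–3 of §4.3.1) -/

/-- **van Enter–Fernández–Sokal 1993, eq. (4.32) with (4.25)–(4.27)** (the outcome of Steps 0–3
of the Griffiths–Pearce–Israel argument for `b = 2` decimation in dimension `d ≥ 3`, §4.3.1;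
"This works for any temperature below the critical temperature of the undiluted
`(d-1)`-dimensional Ising model"). For `d ≥ 3`, `β > β_c(d-1)` (`criticalBeta (d-1)`; see
`VEFS1993_thm42` for why `d = 2` is excluded in the tree) and every infinite-volume Gibbs measure
`μ` of the nearest-neighbour Ising model on `ℤ^d` at `(β, 0)`, writing `ν = μT₂` for the
decimated measure: there is `δ > 0` such that for every `R` there are `R' > R` and levels
`c₊ - c₋ ≥ δ` (`cplus`, `cminus`) with `E_ν(σ'_0 | {σ'_x}_{x≠0}) ≥ c₊` `ν`-a.e. on `𝒩_{R,R',+}` and `≤ c₋` `ν`-a.e.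
on `𝒩_{R,R',-}` — printed as "in every neighborhood of `ω'_alt` there are open sets `𝒩₊, 𝒩₋`
such that `E_{μT}(σ'_0|{σ'_i}_{i≠0})(ω₁) - E_{μT}(σ'_0|{σ'_i}_{i≠0})(ω₂) ≥ δ > 0` for
`ω₁ ∈ 𝒩₊` and `ω₂ ∈ 𝒩₋`" (4.32), with `𝒩_± = 𝒩_{R,R',±}` ((4.25), `ω'_± ≡ ±1`, §4.3.1 Step 2)
and the bounds holding for the conditional expectation as an a.e.-class (§4.1.2 Step 0 and §4.2
Step 2: the computed version is valid "only for `(μT)`-almost-every `ω'`", whence bounds on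
"a nonempty open set of configurations"). Its printed proof: Step 0 (Proposition 2.25), Step 1
(phase transition of the periodically diluted internal-spin system for `J > J_{c,d-1}` by
Griffiths' comparison inequalities), Steps 2.1–2.4 (weak limits of Feller specifications;
uniqueness for `+` image spins via Lee–Yang, Lebowitz–Penrose and Lebowitz' inequality (4.29);
FKG comparison; spontaneous magnetisation), Step 3 (unfixing the origin, (4.7)–(4.13), GKS).
Named fact, not proved here. [cite: VanenterFernandezSokal1993, §4.3.1 eq. (4.32), eqs. (4.25)–(4.27)] -/
def VEFS1993_eq432 : Prop :=
  ∀ d : ℕ, 3 ≤ d → ∀ β : ℝ, criticalBeta (d - 1) < β →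
    ∀ μ ∈ isingGibbsMeasures d β 0, ∃ δ : ℝ, 0 < δ ∧ ∀ R : ℕ, ∃ R' : ℕ, R < R' ∧
      ∃ cplus cminus : ℝ, δ ≤ cplus - cminus ∧
        (∀ᵐ ω ∂(μ.map (decimate d 2)), ω ∈ plusSelected d R R' →
          cplus ≤ condExpSpinAtOrigin d (μ.map (decimate d 2)) ω) ∧
        (∀ᵐ ω ∂(μ.map (decimate d 2)), ω ∈ minusSelected d R R' →
          condExpSpinAtOrigin d (μ.map (decimate d 2)) ω ≤ cminus)

variable {d}

/-! ### Positivity of the phase-selecting sets under the decimated measure -/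

/-- The decimation preimage of a cylinder on the image lattice contains a cylinder on the
original lattice (on the doubled sites `2Λ'`). [cite: VanenterFernandezSokal1993, §4.1.2 Step 0] -/
theorem cylinder_subset_preimage_decimate (Λ' : Finset (Site d)) (s : SpinConfig (Site d)) :
    {σ : SpinConfig (Site d) | ∀ y ∈ Λ'.image (fun x : Site d => fun i => (2 : ℤ) * x i),
        σ y = s (fun i => y i / 2)} ⊆
      decimate d 2 ⁻¹' {ω | ∀ x ∈ Λ', ω x = s x} := by
  intro σ hσ x hx
  have hy : (fun i => (2 : ℤ) * x i) ∈ Λ'.image (fun x : Site d => fun i => (2 : ℤ) * x i) :=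
    Finset.mem_image_of_mem _ hx
  have := hσ _ hy
  simp only [decimate_apply, Nat.cast_ofNat]
  rw [this]
  congr 1
  funext i
  simp

/-- **"Open sets … have strictly positive `(μT)`-measure"** for `𝒩_{R,R',+}`: the decimated
image of an Ising Gibbs measure charges `𝒩_{R,R',+}` (finite energy of `μ` on the cylinder of
original spins `σ_{2x}`, `x ∈ Λ_{R'}`, prescribed by (4.25a)).
[cite: VanenterFernandezSokal1993, §4.1.2 Conclusion of the argument] -/
theorem map_decimate_plusSelected_pos {β h : ℝ} {μ : Measure (SpinConfig (Site d))}
    (hμ : μ ∈ isingGibbsMeasures d β h) (R R' : ℕ) :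
    0 < μ.map (decimate d 2) (plusSelected d R R') := by
  classical
  -- a reference configuration realising (4.25a) on `Λ_{R'}`
  set s : SpinConfig (Site d) := fun x => if x ∈ box d R then altConfig d x else 1 with hs
  have hsub : {ω : SpinConfig (Site d) | ∀ x ∈ box d R ∪ box d R', ω x = s x} ⊆
      plusSelected d R R' := by
    intro ω hω
    refine ⟨fun x hx => ?_, fun x hx hxR => ?_⟩
    · rw [hω x (Finset.mem_union_left _ hx), hs]; simp [hx]
    · rw [hω x (Finset.mem_union_right _ hx), hs]; simp [hxR]
  refine lt_of_lt_of_le ?_ (Measure.le_map_apply (measurable_decimate d 2).aemeasurable _)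
  refine lt_of_lt_of_le ?_ (measure_mono (Set.preimage_mono hsub))
  refine lt_of_lt_of_le ?_ (measure_mono (cylinder_subset_preimage_decimate _ s))
  exact measure_cylinder_pos_of_mem_isingGibbsMeasures hμ _ _

/-- Positivity of `𝒩_{R,R',-}` under the decimated measure (as for `𝒩_{R,R',+}`).
[cite: VanenterFernandezSokal1993, §4.1.2 Conclusion of the argument] -/
theorem map_decimate_minusSelected_pos {β h : ℝ} {μ : Measure (SpinConfig (Site d))}
    (hμ : μ ∈ isingGibbsMeasures d β h) (R R' : ℕ) :
    0 < μ.map (decimate d 2) (minusSelected d R R') := by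
  classical
  set s : SpinConfig (Site d) := fun x => if x ∈ box d R then altConfig d x else -1 with hs
  have hsub : {ω : SpinConfig (Site d) | ∀ x ∈ box d R ∪ box d R', ω x = s x} ⊆
      minusSelected d R R' := by
    intro ω hω
    refine ⟨fun x hx => ?_, fun x hx hxR => ?_⟩
    · rw [hω x (Finset.mem_union_left _ hx), hs]; simp [hx]
    · rw [hω x (Finset.mem_union_right _ hx), hs]; simp [hxR]
  refine lt_of_lt_of_le ?_ (Measure.le_map_apply (measurable_decimate d 2).aemeasurable _)
  refine lt_of_lt_of_le ?_ (measure_mono (Set.preimage_mono hsub))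
  refine lt_of_lt_of_le ?_ (measure_mono (cylinder_subset_preimage_decimate _ s))
  exact measure_cylinder_pos_of_mem_isingGibbsMeasures hμ _ _

/-! ### The image spin at the origin as a bounded continuous observable -/

/-- `σ ↦ σ_0 ∈ ℝ` is continuous for the product (of discrete) topology.
[cite: VanenterFernandezSokal1993, §2.3.4] -/
theorem continuous_spinAt (x : Site d) : Continuous (spinAt (V := Site d) x) :=
  (continuous_of_discreteTopology (f := fun u : ℤˣ => ((u : ℤ) : ℝ))).comp (continuous_apply x)

/-- `|σ_x| ≤ 1` in norm form. [cite: FriedliVelenik2017, §3.1] -/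
theorem norm_spinAt_le_one (x : Site d) (σ : SpinConfig (Site d)) : ‖spinAt x σ‖ ≤ 1 := by
  rcases spinAt_eq_one_or_eq_neg_one x σ with h | h <;> simp [h]

/-- The spin at `x` as a bounded continuous function (an element of `C(Ω')`, to which the Feller
property, Definition 2.14, applies). [cite: VanenterFernandezSokal1993, Definition 2.14] -/
def spinAtBCF (x : Site d) : SpinConfig (Site d) →ᵇ ℝ :=
  BoundedContinuousFunction.mkOfBound ⟨spinAt x, continuous_spinAt x⟩ 2 fun σ τ => by
    rw [Real.dist_eq]
    rcases spinAt_eq_one_or_eq_neg_one x σ with h | h <;>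
      rcases spinAt_eq_one_or_eq_neg_one x τ with h' | h' <;> simp [h, h'] <;> norm_num

/-- `spinAtBCF x σ = σ_x`. [cite: VanenterFernandezSokal1993, Definition 2.14] -/
@[simp] theorem spinAtBCF_apply (x : Site d) (σ : SpinConfig (Site d)) :
    spinAtBCF x σ = spinAt x σ := rfl

/-- Image configurations agreeing with `ω'_alt` on larger and larger cubes `Λ_R` converge to
`ω'_alt` in the product topology (the sets `𝒩_R` of (4.24) form a neighbourhood basis).
[cite: VanenterFernandezSokal1993, eq. (4.24)] -/
theorem tendsto_altConfig_of_eqOn_box {ω : ℕ → SpinConfig (Site d)}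
    (hω : ∀ R, ∀ x ∈ box d R, ω R x = altConfig d x) :
    Tendsto ω atTop (𝓝 (altConfig d)) := by
  rw [tendsto_pi_nhds]
  intro x
  obtain ⟨L, hL⟩ : ∃ L : ℕ, x ∈ box d L := by
    have hx : x ∈ ⋃ L : ℕ, ((box d L : Finset (Site d)) : Set (Site d)) := by
      rw [iUnion_coe_box]; exact Set.mem_univ x
    simpa using hx
  refine tendsto_const_nhds.congr' ?_
  filter_upwards [eventually_ge_atTop L] with R hR
  exact (hω R x (box_mono d hR hL)).symm

/-! ### Assembly: Theorem 4.2 from the estimate (4.32) -/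

/-- **Reduction of Theorem 4.2 to the estimate (4.32)** (van Enter–Fernández–Sokal, §4.1.2 and
§4.3.1, "Conclusion of the argument", made rigorous). Suppose (4.32) and let `μT₂` be consistent
with a Feller (= quasilocal, finite single-spin space) specification `γ'`. Then
`g = γ'_{{0}} σ'_0` is continuous (Feller property applied to the bounded continuous observable
`σ'_0`) and is a version of `E_{μT}(σ'_0 | {σ'_x}_{x≠0})` (`IsGibbsMeasure.integral_ae_eq_condExp`,
Definition 2.6 / Proposition 2.7). The sets `𝒩_{R,R',±}` have positive `μT`-measure
(`map_decimate_plusSelected_pos`), so the a.e. bounds of (4.32) produce points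
`ω₁^R ∈ 𝒩_{R,R',+}`, `ω₂^R ∈ 𝒩_{R,R',-}` with `g(ω₁^R) - g(ω₂^R) ≥ δ`; both sequences converge to
`ω'_alt`, contradicting the continuity of `g` at `ω'_alt`. Hence `μT₂` is consistent with no
quasilocal specification: Theorem 4.2 (as transcribed, `d ≥ 3`).
[cite: VanenterFernandezSokal1993, Theorem 4.2, §4.3.1 Conclusion of the argument, §4.1.2 p. 101] -/
theorem VEFS1993_thm42_of_eq432 (h432 : VEFS1993_eq432) : VEFS1993_thm42 := by
  intro d hd β hβ μ hμ hq
  obtain ⟨γ', hγ', hF, hG⟩ := hq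
  set ν : Measure (SpinConfig (Site d)) := μ.map (decimate d 2) with hν
  -- the continuous version of `E_ν(σ'_0 | 𝓕_{0ᶜ})` provided by the Feller specification
  set g : SpinConfig (Site d) → ℝ := fun η => ∫ σ, spinAt 0 σ ∂(γ' {0} η) with hg
  have hg_cont : Continuous g := hF {0} (spinAtBCF 0)
  have hg_ae : g =ᵐ[ν] condExpSpinAtOrigin d ν :=
    hG.integral_ae_eq_condExp hγ' {0} (measurable_spinAt 0) (norm_spinAt_le_one 0)
  obtain ⟨δ, hδ, hR⟩ := h432 d hd β hβ μ hμ
  -- Step: for every `R`, points of `𝒩_{R,R',±}` where the version `g` obeys the bounds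
  have pts : ∀ R : ℕ, ∃ ω₁ ω₂ : SpinConfig (Site d),
      (∀ x ∈ box d R, ω₁ x = altConfig d x) ∧ (∀ x ∈ box d R, ω₂ x = altConfig d x) ∧
        δ ≤ g ω₁ - g ω₂ := by
    intro R
    obtain ⟨R', -, cplus, cminus, hc, hplus, hminus⟩ := hR R
    have h1 : ∀ᵐ ω ∂ν, ω ∈ plusSelected d R R' → cplus ≤ g ω := by
      filter_upwards [hplus, hg_ae] with ω hω hgω
      intro hmem
      rw [hgω]
      exact hω hmem
    have h2 : ∀ᵐ ω ∂ν, ω ∈ minusSelected d R R' → g ω ≤ cminus := by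
      filter_upwards [hminus, hg_ae] with ω hω hgω
      intro hmem
      rw [hgω]
      exact hω hmem
    obtain ⟨ω₁, hω₁, hg₁⟩ : ∃ ω ∈ plusSelected d R R', cplus ≤ g ω := by
      by_contra hcon
      push Not at hcon
      have hnull : ν (plusSelected d R R') = 0 := by
        refine measure_mono_null (fun ω hω => ?_) (ae_iff.1 h1)
        simp only [Set.mem_setOf_eq, Classical.not_imp, not_le]
        exact ⟨hω, hcon ω hω⟩
      exact (map_decimate_plusSelected_pos hμ R R').ne' hnull
    obtain ⟨ω₂, hω₂, hg₂⟩ : ∃ ω ∈ minusSelected d R R', g ω ≤ cminus := by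
      by_contra hcon
      push Not at hcon
      have hnull : ν (minusSelected d R R') = 0 := by
        refine measure_mono_null (fun ω hω => ?_) (ae_iff.1 h2)
        simp only [Set.mem_setOf_eq, Classical.not_imp, not_le]
        exact ⟨hω, hcon ω hω⟩
      exact (map_decimate_minusSelected_pos hμ R R').ne' hnull
    exact ⟨ω₁, ω₂, eqOn_box_of_mem_plusSelected hω₁, eqOn_box_of_mem_minusSelected hω₂,
      by linarith⟩
  choose ω₁ ω₂ h₁ h₂ hgap using pts
  -- both sequences converge to `ω'_alt`, where `g` is continuous
  have t₁ : Tendsto (fun R => g (ω₁ R)) atTop (𝓝 (g (altConfig d))) :=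
    (hg_cont.tendsto _).comp (tendsto_altConfig_of_eqOn_box h₁)
  have t₂ : Tendsto (fun R => g (ω₂ R)) atTop (𝓝 (g (altConfig d))) :=
    (hg_cont.tendsto _).comp (tendsto_altConfig_of_eqOn_box h₂)
  have t : Tendsto (fun R => g (ω₁ R) - g (ω₂ R)) atTop (𝓝 0) := by
    simpa using t₁.sub t₂
  obtain ⟨R, hR⟩ := (t.eventually (Iio_mem_nhds hδ)).exists
  exact absurd (hgap R) (not_le.2 hR)

/-- **The barrier from the estimate (4.32).** `PositionSpaceRGNonGibbsian` (= Theorem 4.2 as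
transcribed) follows from `VEFS1993_eq432`; what remains to discharge the barrier is exactly the
Griffiths–Pearce–Israel estimate (Steps 0–3 of §4.3.1).
[cite: VanenterFernandezSokal1993, Theorem 4.2 and eq. (4.32)] -/
theorem positionSpaceRGNonGibbsian_of_eq432 (h432 : VEFS1993_eq432) :
    PositionSpaceRGNonGibbsian :=
  positionSpaceRGNonGibbsian_iff.2 (VEFS1993_thm42_of_eq432 h432)

end GPI

/-! ### Non-vacuity of the barrier: the Ising specification is quasilocal (Feller), so the
un-renormalised Gibbs measures are quasilocal and the technique class is inhabited at `b = 1` -/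

section Feller

variable {W : Type*}

/-- Gluing a finite configuration inside `Λ` with the boundary condition `η` outside depends
continuously on `η` (product topology). [cite: VanenterFernandezSokal1993, §2.3.4] -/
theorem continuous_glue_fixed (Λ : Finset W) (τ : Λ → ℤˣ) :
    Continuous fun η : SpinConfig W => glue Λ τ (.fixed η) := by
  refine continuous_pi fun x => ?_
  by_cases hx : x ∈ Λ
  · simp only [glue_apply_of_mem _ _ _ hx]
    exact continuous_const
  · simp only [glue_apply_of_notMem _ _ _ hx, BoundaryCondition.outside_fixed]
    exact continuous_apply x

/-- `σ ↦ σ_x ∈ ℝ` is continuous on `SpinConfig W` (any site set). [cite: VanenterFernandezSokal1993, §2.3.4] -/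
theorem continuous_spinAt_site (x : W) : Continuous (spinAt (V := W) x) :=
  (continuous_of_discreteTopology (f := fun u : ℤˣ => ((u : ℤ) : ℝ))).comp (continuous_apply x)

/-- The bond observable `σ ↦ σ_x σ_y` is continuous. [cite: VanenterFernandezSokal1993, §2.3.4] -/
theorem continuous_bondSpin (e : Sym2 W) : Continuous fun σ : SpinConfig W => bondSpin σ e := by
  induction e using Sym2.ind with
  | _ x y =>
    simp only [bondSpin_mk]
    exact (continuous_spinAt_site x).mul (continuous_spinAt_site y)

variable (G : SimpleGraph W) [DecidableEq W] [G.LocallyFinite]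

/-- The finite-volume Ising Hamiltonian is a continuous (indeed local) function of the
configuration. [cite: FriedliVelenik2017, §3.1 eq. (3.6)] -/
theorem continuous_isingHamiltonian (Λ : Finset W) (h : ℝ) (bc : BoundaryCondition W) :
    Continuous (isingHamiltonian G Λ h bc) := by
  unfold isingHamiltonian
  exact (continuous_finsetSum _ fun e _ => continuous_bondSpin e).neg.sub
    (continuous_const.mul (continuous_finsetSum _ fun x _ => continuous_spinAt_site x))

/-- The Boltzmann weight of a finite configuration depends continuously on the fixed boundary
condition. [cite: FriedliVelenik2017, §3.1 eq. (3.7)] -/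
theorem continuous_isingWeight_fixed (Λ : Finset W) (β h : ℝ) (τ : Λ → ℤˣ) :
    Continuous fun η : SpinConfig W => isingWeight G Λ β h (.fixed η) τ := by
  have hc : Continuous fun η : SpinConfig W =>
      Real.exp (-β * isingHamiltonian G Λ h (.fixed 1) (glue Λ τ (.fixed η))) :=
    Real.continuous_exp.comp (continuous_const.mul
      ((continuous_isingHamiltonian G Λ h (.fixed 1)).comp (continuous_glue_fixed Λ τ)))
  refine hc.congr fun η => ?_
  unfold isingWeight
  rw [isingHamiltonian_fixed_eq_fixed_one G Λ h η]

/-- The partition function depends continuously on the fixed boundary condition.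
[cite: FriedliVelenik2017, §3.1 eq. (3.4)] -/
theorem continuous_isingPartitionFunction_fixed (Λ : Finset W) (β h : ℝ) :
    Continuous fun η : SpinConfig W => isingPartitionFunction G Λ β h (.fixed η) := by
  unfold isingPartitionFunction
  exact continuous_finsetSum _ fun τ _ => continuous_isingWeight_fixed G Λ β h τ

/-- **The Ising specification is Feller** (= quasilocal, the single-spin space being finite;
van Enter–Fernández–Sokal Definition 2.14 and Theorem 2.12 / Example: every finite-range
interaction has a quasilocal specification): for bounded continuous `f`,
`η ↦ γ_Λ(f | η) = (∑_τ w_η(τ) f(τ ∨ η)) / Z_η` is a finite sum of continuous functions of `η`.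
[cite: VanenterFernandezSokal1993, Definition 2.14 and §2.3.3] -/
theorem isFeller_isingSpecification [Countable W] (β h : ℝ) :
    Specification.IsFeller (isingSpecification G β h) := by
  intro Λ f
  have hf : Measurable (f : SpinConfig W → ℝ) := f.continuous.measurable
  have heq : (fun η : SpinConfig W => ∫ σ, f σ ∂(isingSpecification G β h Λ η)) = fun η =>
      (∑ τ : Λ → ℤˣ, isingWeight G Λ β h (.fixed η) τ * f (glue Λ τ (.fixed η))) /
        isingPartitionFunction G Λ β h (.fixed η) := by
    funext η
    rw [isingSpecification_apply, integral_isingMeasure G Λ β h _ hf]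
  rw [heq]
  refine Continuous.div (continuous_finsetSum _ fun τ _ => ?_)
    (continuous_isingPartitionFunction_fixed G Λ β h)
    fun η => (isingPartitionFunction_pos G Λ β h _).ne'
  exact (continuous_isingWeight_fixed G Λ β h τ).mul
    (f.continuous.comp (continuous_glue_fixed Λ τ))

end Feller

/-- **Ising Gibbs measures are quasilocal**: every infinite-volume Gibbs measure of the
nearest-neighbour Ising model on `ℤ^d` is consistent with a quasilocal (Feller) specification,
namely the Ising specification itself (van Enter–Fernández–Sokal §2.3.3: Gibbs measures of
uniformly convergent interactions are quasilocal). [cite: VanenterFernandezSokal1993, §2.3.3 and Definition 2.13] -/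
theorem isQuasilocalMeasure_of_mem_isingGibbsMeasures {d : ℕ} {β h : ℝ}
    {μ : Measure (SpinConfig (Site d))} (hμ : μ ∈ isingGibbsMeasures d β h) :
    IsQuasilocalMeasure μ :=
  ⟨isingSpecification (zdGraph d) β h, isSpecification_isingSpecification_zd_holds d β h,
    isFeller_isingSpecification (zdGraph d) β h, (mem_isingGibbsMeasures_iff d β h μ).1 hμ⟩

/-- **The technique class is inhabited at spacing `b = 1`** (no hypothesis left, cf.
`renormalizedHamiltonianExists_decimate_one`): for every `β ≥ 0` and every field `h`, the plus
state is an Ising Gibbs measure whose (trivially) renormalised image is quasilocal. So the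
obstruction `¬ RenormalizedHamiltonianExists d (decimate d 2) β 0` of the barrier is a genuine
effect of the coarse-graining, not an artefact of an uninhabitable predicate.
[cite: VanenterFernandezSokal1993, §3.1.2 eq. (3.7) and Definition 3.1] -/
theorem renormalizedHamiltonianExists_decimate_one_of_nonneg (d : ℕ) {β : ℝ} (hβ : 0 ≤ β)
    (h : ℝ) : RenormalizedHamiltonianExists d (decimate d 1) β h := by
  obtain ⟨μ, hμ, -⟩ := exists_plusMeasure_holds (d := d) (h := h) hβ
  exact renormalizedHamiltonianExists_decimate_one hμ
    (isQuasilocalMeasure_of_mem_isingGibbsMeasures hμ)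

/-- **Non-vacuity of the barrier's conclusion**: quasilocal probability measures on
`{±1}^{ℤ^d}` exist (e.g. any Ising Gibbs measure), so `¬ IsQuasilocalMeasure (μT₂)` in
`VEFS1993_thm42` / `PositionSpaceRGNonGibbsian` is not true for lack of quasilocal measures.
[cite: VanenterFernandezSokal1993, Definition 2.13] -/
theorem exists_isQuasilocalMeasure (d : ℕ) :
    ∃ ν : Measure (SpinConfig (Site d)), IsQuasilocalMeasure ν := by
  obtain ⟨μ, hμ, -⟩ := exists_plusMeasure_holds (d := d) (β := 0) (h := 0) le_rfl
  exact ⟨μ, isQuasilocalMeasure_of_mem_isingGibbsMeasures hμ⟩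

/-- **The barrier separates `b = 2` from `b = 1` at the same points of the phase diagram**:
under Theorem 4.2 (`PositionSpaceRGNonGibbsian`, proved downstream in `…Holds.lean`), for
`d ≥ 3` and `β > β_c(d-1)` the identity step acts on Hamiltonians at `(β, 0)` while the
spacing-2 decimation does not. [cite: VanenterFernandezSokal1993, Theorem 4.2 and Definition 3.1] -/
theorem renormalizedHamiltonianExists_one_not_two (h42 : PositionSpaceRGNonGibbsian) {d : ℕ}
    (hd : 3 ≤ d) {β : ℝ} (hβ : criticalBeta (d - 1) < β) :
    RenormalizedHamiltonianExists d (decimate d 1) β 0 ∧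
      ¬ RenormalizedHamiltonianExists d (decimate d 2) β 0 :=
  ⟨renormalizedHamiltonianExists_decimate_one_of_nonneg d
      ((criticalBeta_nonneg (d - 1)).trans hβ.le) 0,
    not_renormalizedHamiltonianExists_of_thm42 (positionSpaceRGNonGibbsian_iff.1 h42) hd hβ⟩

end Literature.Barriers.CriticalPhenomena.NonGibbs

end
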